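import Summits.CriticalPhenomena.CardyFormulaZ2.Theorems.CardyMagicRigidityNestingRigidityOneGenerationZ2Cells
import Literature.Probability.Percolation.FKLoopWindingCells
import HarnessLib

/-!
# Winding interiors of interface loops: nested or disjoint; locality of the inside loops

Crux `Summit.CriticalPhenomena.CardyFormulaZ2.Theses.CardyMagicRigidity.NestingRigidity`
(stmt-CriticalPhenomena-4835), line `markov-cascade-one-generation`, helper toward stub
`stub_oneGenerationZ2 : OneGenerationZ2` (S1).

From the cell trichotomy (`interfaceLoop_cells_nested_or_disjoint`, module `…OneGenerationZ2Cells`)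
to the plane: for interface loops `γ₁, γ₂` of one bond configuration of `ℤ²` the WINDING INTERIORS
`{z | (loopCurve δ 0 γᵢ).wind z ≠ 0}` (any mesh `δ ≠ 0`) satisfy
`int γ₁ ⊆ int γ₂ ∨ int γ₂ ⊆ int γ₁ ∨ int γ₁ ∩ int γ₂ = ∅`
(`interfaceLoop_interiors_nested_or_disjoint`, registered helper; `setOf_wind_loopCurve_mesh`
rescales).
The passage uses that a point off the trace has the winding number of the centre of a closed
`ℓ¹`-cell containing it (`IsInterfaceLoop.wind_eq_wind_of_l1DistC_le`), that the cells tile the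
plane (`exists_l1DistC_le_half`), and that a point of the trace of `γ₂` interior to `γ₁` would put
both cells of a dart of `γ₂` inside `γ₁` (`not_mem_range_of_cells_subset`), which the jump relation
across that dart forbids once the cells of `γ₁` are cells of `γ₂`.

Then the LOCALITY inputs of the one-generation factorisation:
* `isInterfaceLoop_of_forall_mem_iff` / `isInterfaceLoop_iff_of_forall_mem_iff` — **cylinder
  property**: "`γ` is an interface loop of `ω`" reads `ω` only on the entries of `γ` (the turning
  rule reads the state of the
  middle edge, a lattice edge, and "dual-open" means "closed" for every configuration,
  `dualEdge_mem_dualConfig_iff_notMem`);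
* `cSrc_eq_of_medialPoint_eq` — a lattice edge is determined by its midpoint, whence
  `medialPoint_not_mem_range`: the midpoint of a lattice edge NOT on `γ` is off the trace of `γ`
  (distinct medial darts meet only at common medial points,
  `IsMedialDart.segment_inter_segment_subset`);
* `exists_eq_cSrc_of_mem` — every entry of an interface loop is the source edge of a dart with an
  interior cell, and `wind_medialPoint_cSrc_ne_zero` — an edge off `γ` at a corner with a cell
  interior to `γ` has its midpoint strictly inside `γ`.  Hence a loop inside `γ` only visits entries
  of `γ` and edges strictly inside `γ`.
-/

noncomputable section

open Set Function

namespace Summit.CriticalPhenomena.CardyFormulaZ2.Cruxes.NestingRigidity.MarkovCascadeOneGeneration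

open Literature.Probability.RandomPlanarGeometry Literature.Probability.Percolation
  Literature.Probability.LatticeModels

variable {ω ω' ω₀ ω₁ ω₂ : BondConfig (Site 2)} {γ γ' γ₁ γ₂ : List MedialVertex}

/-! ## A corner cut lies in the closed cells of both its vertex and its face -/

/-- A point of the corner cut of `(v, f)` is at `ℓ¹`-distance `1/2` from the lattice point `v`
(the cut is the common side of the diamond cells of `v` and of the centre of `f`). -/
theorem l1DistC_meshPoint_eq_of_mem_cornerCut {v f : Site 2} (hv : IsCorner v f) {z : ℂ}
    (hz : z ∈ cornerCut v f) : l1DistC z (meshPoint 1 v) = 1 / 2 := by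
  obtain ⟨hd, hq0, hq1⟩ := (mem_cornerCut_iff hv).1 hz
  rw [meshPoint_one_eq_faceCenter_add hv]
  unfold l1DistC at hd ⊢
  set a : ℝ := z.re - (faceCenter f).re with ha
  set b : ℝ := z.im - (faceCenter f).im with hb
  have ea : z.re - ((faceCenter f).re + cornerSign v f 0 / 2) = a - cornerSign v f 0 / 2 := by
    rw [ha]; ring
  have eb : z.im - ((faceCenter f).im + cornerSign v f 1 / 2) = b - cornerSign v f 1 / 2 := by
    rw [hb]; ring
  simp only [ea, eb]
  rcases cornerSign_eq_or v f 0 with h0 | h0 <;> rcases cornerSign_eq_or v f 1 with h1 | h1 <;>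
    rw [h0] at hq0 ⊢ <;> rw [h1] at hq1 ⊢
  · rw [abs_of_nonneg (by linarith), abs_of_nonneg (by linarith)] at hd
    rw [abs_of_nonpos (by linarith), abs_of_nonpos (by linarith)]
    linarith
  · rw [abs_of_nonneg (by linarith), abs_of_nonpos (by linarith)] at hd
    rw [abs_of_nonpos (by linarith), abs_of_nonneg (by linarith)]
    linarith
  · rw [abs_of_nonpos (by linarith), abs_of_nonneg (by linarith)] at hd
    rw [abs_of_nonneg (by linarith), abs_of_nonpos (by linarith)]
    linarith
  · rw [abs_of_nonpos (by linarith), abs_of_nonpos (by linarith)] at hd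
    rw [abs_of_nonneg (by linarith), abs_of_nonneg (by linarith)]
    linarith

/-- On the corner cut of `(v, f)` a loop `γ₁` not passing there has the winding number of `v` and
of the centre of `f`. -/
theorem wind_eq_of_mem_cornerCut (h₁ : IsInterfaceLoop ω₁ γ₁) {v f : Site 2} (hv : IsCorner v f)
    {z : ℂ} (hz : z ∈ cornerCut v f) (hzr : z ∉ (loopCurve 1 0 γ₁).range) :
    (loopCurve 1 0 γ₁).wind z = (loopCurve 1 0 γ₁).wind (meshPoint 1 v) ∧
      (loopCurve 1 0 γ₁).wind z = (loopCurve 1 0 γ₁).wind (faceCenter f) :=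
  ⟨h₁.wind_eq_wind_of_l1DistC_le hzr (l1DistC_meshPoint_eq_of_mem_cornerCut hv hz).le
      fun _ hx ↦ h₁.half_le_l1DistC_meshPoint hx v,
    h₁.wind_eq_wind_of_l1DistC_le hzr (l1DistC_eq_of_mem_cornerCut hv hz).le
      fun _ hx ↦ h₁.half_le_l1DistC_faceCenter hx f⟩

/-- **No point of the trace of `γ₂` is interior to `γ₁`** once the interior cells of `γ₁` are
interior cells of `γ₂`: such a point lies on the cut of a dart of `γ₂`, whose two cells would both
be interior to `γ₁`, hence to `γ₂` — but across a dart exactly one cell is interior. -/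
theorem not_mem_range_of_cells_subset (h₁ : IsInterfaceLoop ω₁ γ₁) (h₂ : IsInterfaceLoop ω₂ γ₂)
    (hV : ∀ v : Site 2, (loopCurve 1 0 γ₁).wind (meshPoint 1 v) ≠ 0 →
      (loopCurve 1 0 γ₂).wind (meshPoint 1 v) ≠ 0)
    (hF : ∀ f : Site 2, (loopCurve 1 0 γ₁).wind (faceCenter f) ≠ 0 →
      (loopCurve 1 0 γ₂).wind (faceCenter f) ≠ 0)
    {z : ℂ} (hz : (loopCurve 1 0 γ₁).wind z ≠ 0) : z ∉ (loopCurve 1 0 γ₂).range := by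
  intro hzr
  have hz1 : z ∉ (loopCurve 1 0 γ₁).range := fun h ↦ hz ((loopCurve 1 0 γ₁).wind_of_mem_range h)
  obtain ⟨q, hq, v, f, hv, hs, ht, hzc⟩ := exists_cornerCut_of_mem_range_loopCurve h₂ hzr
  obtain ⟨ev, ef⟩ := wind_eq_of_mem_cornerCut h₁ hv hzc hz1
  have hPv := hV v (ev ▸ hz)
  have hQf := hF f (ef ▸ hz)
  have hd : (cornerSource v f, cornerTarget v f) ∈ γ₂.zip (γ₂.rotate 1) := by rwa [hs, ht]
  have hj := h₂.wind_meshPoint_eq_wind_faceCenter_add_one hv hd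
  rcases h₂.wind_cells with ⟨hv', hf'⟩ | ⟨hv', hf'⟩ <;>
    rcases hv' v with e₁ | e₁ <;> rcases hf' f with e₂ | e₂ <;> omega

/-- **Cells to points, inclusion.** If the interior cells of `γ₁` are interior cells of `γ₂`, the
winding interior of `γ₁` is contained in that of `γ₂`. -/
theorem setOf_wind_ne_zero_subset_of_cells (h₁ : IsInterfaceLoop ω₁ γ₁) (h₂ : IsInterfaceLoop ω₂ γ₂)
    (hV : ∀ v : Site 2, (loopCurve 1 0 γ₁).wind (meshPoint 1 v) ≠ 0 →
      (loopCurve 1 0 γ₂).wind (meshPoint 1 v) ≠ 0)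
    (hF : ∀ f : Site 2, (loopCurve 1 0 γ₁).wind (faceCenter f) ≠ 0 →
      (loopCurve 1 0 γ₂).wind (faceCenter f) ≠ 0) :
    {z | (loopCurve 1 0 γ₁).wind z ≠ 0} ⊆ {z | (loopCurve 1 0 γ₂).wind z ≠ 0} := by
  intro z (hz : (loopCurve 1 0 γ₁).wind z ≠ 0)
  have hz1 : z ∉ (loopCurve 1 0 γ₁).range := fun h ↦ hz ((loopCurve 1 0 γ₁).wind_of_mem_range h)
  have hz2 : z ∉ (loopCurve 1 0 γ₂).range := not_mem_range_of_cells_subset h₁ h₂ hV hF hz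
  rcases exists_l1DistC_le_half z with ⟨v, hv⟩ | ⟨f, hf⟩
  · have e₁ := h₁.wind_eq_wind_of_l1DistC_le hz1 hv fun x hx ↦ h₁.half_le_l1DistC_meshPoint hx v
    have e₂ := h₂.wind_eq_wind_of_l1DistC_le hz2 hv fun x hx ↦ h₂.half_le_l1DistC_meshPoint hx v
    show (loopCurve 1 0 γ₂).wind z ≠ 0
    rw [e₂]
    exact hV v (e₁ ▸ hz)
  · have e₁ := h₁.wind_eq_wind_of_l1DistC_le hz1 hf fun x hx ↦ h₁.half_le_l1DistC_faceCenter hx f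
    have e₂ := h₂.wind_eq_wind_of_l1DistC_le hz2 hf fun x hx ↦ h₂.half_le_l1DistC_faceCenter hx f
    show (loopCurve 1 0 γ₂).wind z ≠ 0
    rw [e₂]
    exact hF f (e₁ ▸ hz)

/-- **Cells to points, disjointness.** If no cell is interior to both loops, the winding interiors
are disjoint. -/
theorem disjoint_setOf_wind_ne_zero_of_cells (h₁ : IsInterfaceLoop ω₁ γ₁)
    (h₂ : IsInterfaceLoop ω₂ γ₂)
    (hV : ∀ v : Site 2, (loopCurve 1 0 γ₁).wind (meshPoint 1 v) ≠ 0 →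
      (loopCurve 1 0 γ₂).wind (meshPoint 1 v) = 0)
    (hF : ∀ f : Site 2, (loopCurve 1 0 γ₁).wind (faceCenter f) ≠ 0 →
      (loopCurve 1 0 γ₂).wind (faceCenter f) = 0) :
    Disjoint {z | (loopCurve 1 0 γ₁).wind z ≠ 0} {z | (loopCurve 1 0 γ₂).wind z ≠ 0} := by
  refine disjoint_left.2 fun z (hz : (loopCurve 1 0 γ₁).wind z ≠ 0)
    (hz' : (loopCurve 1 0 γ₂).wind z ≠ 0) ↦ ?_
  have hz1 : z ∉ (loopCurve 1 0 γ₁).range := fun h ↦ hz ((loopCurve 1 0 γ₁).wind_of_mem_range h)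
  have hz2 : z ∉ (loopCurve 1 0 γ₂).range := fun h ↦ hz' ((loopCurve 1 0 γ₂).wind_of_mem_range h)
  rcases exists_l1DistC_le_half z with ⟨v, hv⟩ | ⟨f, hf⟩
  · have e₁ := h₁.wind_eq_wind_of_l1DistC_le hz1 hv fun x hx ↦ h₁.half_le_l1DistC_meshPoint hx v
    have e₂ := h₂.wind_eq_wind_of_l1DistC_le hz2 hv fun x hx ↦ h₂.half_le_l1DistC_meshPoint hx v
    exact (e₂ ▸ hz') (hV v (e₁ ▸ hz))
  · have e₁ := h₁.wind_eq_wind_of_l1DistC_le hz1 hf fun x hx ↦ h₁.half_le_l1DistC_faceCenter hx f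
    have e₂ := h₂.wind_eq_wind_of_l1DistC_le hz2 hf fun x hx ↦ h₂.half_le_l1DistC_faceCenter hx f
    exact (e₂ ▸ hz') (hF f (e₁ ▸ hz))

/-! ## The interior trichotomy, at mesh `1` and at any mesh -/

/-- **Winding interiors of two interface loops of one configuration are nested or disjoint**
(mesh `1`; registered helper toward `stub_oneGenerationZ2`). -/
theorem interfaceLoop_interiors_nested_or_disjoint : ∀ (ω : BondConfig (Site 2))
    (γ₁ γ₂ : List MedialVertex), IsInterfaceLoop ω γ₁ → IsInterfaceLoop ω γ₂ →
    {z | (loopCurve 1 0 γ₁).wind z ≠ 0} ⊆ {z | (loopCurve 1 0 γ₂).wind z ≠ 0} ∨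
    {z | (loopCurve 1 0 γ₂).wind z ≠ 0} ⊆ {z | (loopCurve 1 0 γ₁).wind z ≠ 0} ∨
    Disjoint {z | (loopCurve 1 0 γ₁).wind z ≠ 0} {z | (loopCurve 1 0 γ₂).wind z ≠ 0} := by
  intro ω γ₁ γ₂ h₁ h₂
  rcases interfaceLoop_cells_nested_or_disjoint ω γ₁ γ₂ h₁ h₂ with ⟨hV, hF⟩ | ⟨hV, hF⟩ | ⟨hV, hF⟩
  · exact Or.inl (setOf_wind_ne_zero_subset_of_cells h₁ h₂ hV hF)
  · exact Or.inr (Or.inl (setOf_wind_ne_zero_subset_of_cells h₂ h₁ hV hF))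
  · exact Or.inr (Or.inr (disjoint_setOf_wind_ne_zero_of_cells h₁ h₂ hV hF))

/-- The winding interior at mesh `δ ≠ 0` is the rescaled winding interior at mesh `1`. -/
theorem setOf_wind_loopCurve_mesh {δ : ℝ} (hδ : δ ≠ 0) (γ : List MedialVertex) :
    {z | (loopCurve δ 0 γ).wind z ≠ 0} =
      (fun z : ℂ ↦ z / δ) ⁻¹' {w | (loopCurve 1 0 γ).wind w ≠ 0} := by
  ext z
  simp only [mem_setOf_eq, mem_preimage, wind_loopCurve_mesh hδ]

/-- **The interior trichotomy at mesh `δ ≠ 0`.** -/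
theorem interfaceLoop_interiors_nested_or_disjoint_mesh {δ : ℝ} (hδ : δ ≠ 0)
    (h₁ : IsInterfaceLoop ω γ₁) (h₂ : IsInterfaceLoop ω γ₂) :
    {z | (loopCurve δ 0 γ₁).wind z ≠ 0} ⊆ {z | (loopCurve δ 0 γ₂).wind z ≠ 0} ∨
    {z | (loopCurve δ 0 γ₂).wind z ≠ 0} ⊆ {z | (loopCurve δ 0 γ₁).wind z ≠ 0} ∨
    Disjoint {z | (loopCurve δ 0 γ₁).wind z ≠ 0} {z | (loopCurve δ 0 γ₂).wind z ≠ 0} := by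
  rw [setOf_wind_loopCurve_mesh hδ γ₁, setOf_wind_loopCurve_mesh hδ γ₂]
  rcases interfaceLoop_interiors_nested_or_disjoint ω γ₁ γ₂ h₁ h₂ with h | h | h
  · exact Or.inl (preimage_mono h)
  · exact Or.inr (Or.inl (preimage_mono h))
  · exact Or.inr (Or.inr (h.preimage _))

/-! ## The cylinder property of `IsInterfaceLoop` -/

/-- The turning rule at `e₁` reads only the state of the lattice edge `e₁`. -/
theorem isMedialTurn_of_mem_iff {e₀ e₁ e₂ : MedialVertex} (he : e₁ ∈ ω ↔ e₁ ∈ ω')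
    (h : IsMedialTurn ω e₀ e₁ e₂) : IsMedialTurn ω' e₀ e₁ e₂ := by
  obtain ⟨v₁, f₁, v₂, f₂, hc₁, hs₁, ht₁, hc₂, hs₂, ht₂, hor⟩ := h
  refine ⟨v₁, f₁, v₂, f₂, hc₁, hs₁, ht₁, hc₂, hs₂, ht₂, ?_⟩
  have he₁ : e₁ ∈ (zdGraph 2).edgeSet := ht₁ ▸ cornerTarget_mem_edgeSet hc₁
  rcases hor with ⟨hv, hd⟩ | ⟨hf, hm⟩
  · exact Or.inl ⟨hv, (dualEdge_mem_dualConfig_iff_notMem he₁).2 fun h' ↦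
      (dualEdge_mem_dualConfig_iff_notMem he₁).1 hd (he.2 h')⟩
  · exact Or.inr ⟨hf, he.1 hm⟩

/-- **Cylinder property**: two configurations agreeing on the entries of `γ` have `γ` as an
interface loop simultaneously. -/
theorem isInterfaceLoop_of_forall_mem_iff (hγ : ∀ e ∈ γ, (e ∈ ω ↔ e ∈ ω'))
    (h : IsInterfaceLoop ω γ) : IsInterfaceLoop ω' γ :=
  ⟨h.ne_nil, h.nodup, fun i hi ↦ isMedialTurn_of_mem_iff (hγ _ (List.getElem_mem _)) (h.turn i hi)⟩

/-- Cylinder property, `iff` form. -/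
theorem isInterfaceLoop_iff_of_forall_mem_iff (hγ : ∀ e ∈ γ, (e ∈ ω ↔ e ∈ ω')) :
    IsInterfaceLoop ω γ ↔ IsInterfaceLoop ω' γ :=
  ⟨isInterfaceLoop_of_forall_mem_iff hγ,
    isInterfaceLoop_of_forall_mem_iff fun e he ↦ (hγ e he).symm⟩

/-! ## A lattice edge is determined by its midpoint -/

/-- Two coded lattice edges `cSrc p = {x, x + u_k}`, `cSrc q = {y, y + u_j}` with the same midpoint
at mesh `1` are equal. -/
theorem cSrc_eq_of_medialPoint_eq {p q : Site 2 × Fin 4}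
    (h : medialPoint 1 (cSrc p) = medialPoint 1 (cSrc q)) : cSrc p = cSrc q := by
  obtain ⟨x, k⟩ := p
  obtain ⟨y, j⟩ := q
  have hre := congrArg Complex.re h
  have him := congrArg Complex.im h
  simp only [cSrc, medialPoint_mk, Complex.div_ofNat_re, Complex.div_ofNat_im, Complex.add_re,
    Complex.add_im, meshPoint_re, meshPoint_im, one_mul, Pi.add_apply, Int.cast_add] at hre him
  have e0 : ((2 * x 0 + cornerUnit k 0 : ℤ) : ℝ) = (2 * y 0 + cornerUnit j 0 : ℤ) := by
    push_cast; linarith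
  have e1 : ((2 * x 1 + cornerUnit k 1 : ℤ) : ℝ) = (2 * y 1 + cornerUnit j 1 : ℤ) := by
    push_cast; linarith
  have E0 : 2 * x 0 + cornerUnit k 0 = 2 * y 0 + cornerUnit j 0 := by exact_mod_cast e0
  have E1 : 2 * x 1 + cornerUnit k 1 = 2 * y 1 + cornerUnit j 1 := by exact_mod_cast e1
  -- either the same coded edge, or the same edge coded from its other endpoint
  have key : (y = x ∧ j = k) ∨ (y = x + cornerUnit k ∧ j = k + 2) := by
    fin_cases k <;> fin_cases j <;>
      simp only [cornerUnit, Pi.single_eq_same, Pi.single_eq_of_ne (by decide : (1 : Fin 2) ≠ 0),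
        Pi.single_eq_of_ne (by decide : (0 : Fin 2) ≠ 1), Pi.neg_apply] at E0 E1 <;>
      first
        | (exfalso; omega)
        | (left; exact ⟨funext fun i ↦ by fin_cases i <;> simp <;> omega, by decide⟩)
        | (right; exact ⟨funext fun i ↦ by fin_cases i <;> simp [cornerUnit] <;> omega, by decide⟩)
  rcases key with ⟨rfl, rfl⟩ | ⟨rfl, rfl⟩
  · rfl
  · simp only [cSrc, cornerUnit_add_two, ← sub_eq_add_neg, add_sub_cancel_right, Sym2.eq_swap]

/-! ## Midpoints of edges off the loop are off its trace -/

/-- The target edge of a coded corner is the source edge of the next corner around the vertex. -/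
theorem cTgt_eq_cSrc_succ (p : Site 2 × Fin 4) : cTgt p = cSrc (p.1, p.2 + 1) := rfl

/-- **The midpoint of a lattice edge not on `γ` is off the trace of `γ`.** A point of the trace
lies on the cut of a dart `(e₁, e₂)` of `γ`; the cut of the dart `(cSrc p, cTgt p)` starts at the
midpoint of `cSrc p`; distinct medial darts meet only at common medial points, so the midpoint of
`cSrc p` is the midpoint of `e₁` or of `e₂`, whence `cSrc p ∈ γ`. -/
theorem medialPoint_not_mem_range (h : IsInterfaceLoop ω₀ γ) {p : Site 2 × Fin 4}
    (hp : cSrc p ∉ γ) : medialPoint 1 (cSrc p) ∉ (loopCurve 1 0 γ).range := by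
  intro hm
  rw [range_loopCurve_one_zero h.ne_nil] at hm
  simp only [mem_iUnion, exists_prop] at hm
  obtain ⟨⟨e₁, e₂⟩, hq, hm⟩ := hm
  have he₁ : e₁ ∈ γ := (List.of_mem_zip hq).1
  have he₂ : e₂ ∈ γ := List.mem_rotate.1 (List.of_mem_zip hq).2
  have hd₁ : IsMedialDart e₁ e₂ := h.isMedialDart_of_mem_zip hq
  have hd₂ : IsMedialDart (cSrc p) (cTgt p) := isMedialDart_iff_exists_corner.2 ⟨p, rfl, rfl⟩
  by_cases hne : (cSrc p, cTgt p) = (e₁, e₂)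
  · exact hp ((Prod.mk.inj hne).1 ▸ he₁)
  have hmem := hd₂.segment_inter_segment_subset hd₁ hne ⟨left_mem_segment ℝ _ _, hm⟩
  -- `e₁`, `e₂` are coded lattice edges
  obtain ⟨q, hq₁, hq₂⟩ := isMedialDart_iff_exists_corner.1 hd₁
  rcases hmem.2 with h₁ | h₂
  · rw [← hq₁] at h₁ he₁
    exact hp (cSrc_eq_of_medialPoint_eq h₁ ▸ he₁)
  · rw [← hq₂, cTgt_eq_cSrc_succ] at h₂ he₂
    exact hp (cSrc_eq_of_medialPoint_eq h₂ ▸ he₂)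

/-! ## Locality of the inside loops -/

/-- A dart of an interface loop has an interior cell: its left vertex or its right face has
non-zero winding number (jump relation). -/
theorem wind_fst_ne_zero_or (h' : IsInterfaceLoop ω γ') {p : Site 2 × Fin 4}
    (hp : (cSrc p, cTgt p) ∈ γ'.zip (γ'.rotate 1)) :
    (loopCurve 1 0 γ').wind (meshPoint 1 p.1) ≠ 0 ∨
      (loopCurve 1 0 γ').wind (faceCenter (cFace p)) ≠ 0 := by
  have hj := h'.wind_sub_wind_cFace p
  rw [if_pos hp] at hj
  omega

/-- **Every entry of an interface loop is the source edge of a dart with an interior cell.** -/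
theorem exists_eq_cSrc_of_mem (h' : IsInterfaceLoop ω γ') {e : MedialVertex} (he : e ∈ γ') :
    ∃ p : Site 2 × Fin 4, e = cSrc p ∧
      ((loopCurve 1 0 γ').wind (meshPoint 1 p.1) ≠ 0 ∨
        (loopCurve 1 0 γ').wind (faceCenter (cFace p)) ≠ 0) := by
  obtain ⟨i, hi, rfl⟩ := List.getElem_of_mem he
  obtain ⟨p, hps, hpt⟩ := h'.exists_corner i
  have hps' : cSrc p = γ'[i] := by
    rw [hps]; exact IsInterfaceLoop.getElem_idx_congr (Nat.mod_eq_of_lt hi) _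
  have hp : (cSrc p, cTgt p) ∈ γ'.zip (γ'.rotate 1) := by
    rw [hps, hpt]; exact h'.getElem_mod_mem_zip i
  exact ⟨p, hps'.symm, wind_fst_ne_zero_or h' hp⟩

/-- **The midpoint of an edge off `γ` has the winding number of both cells of any of its corners**
(it is a common corner of their closed `ℓ¹`-cells and is off the trace). -/
theorem wind_medialPoint_cSrc_eq (h : IsInterfaceLoop ω₀ γ) {p : Site 2 × Fin 4} (hp : cSrc p ∉ γ) :
    (loopCurve 1 0 γ).wind (medialPoint 1 (cSrc p)) = (loopCurve 1 0 γ).wind (meshPoint 1 p.1) ∧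
      (loopCurve 1 0 γ).wind (medialPoint 1 (cSrc p)) =
        (loopCurve 1 0 γ).wind (faceCenter (cFace p)) := by
  have hoff : medialPoint 1 (cSrc p) ∉ (loopCurve 1 0 γ).range := medialPoint_not_mem_range h hp
  -- the midpoint of `cSrc p` is the first endpoint of the cut of `p`
  have hcut : medialPoint 1 (cSrc p) ∈ cornerCut p.1 (cFace p) := by
    obtain ⟨v, f, hv, hs, ht, hseg⟩ :=
      (isMedialDart_iff_exists_corner.2 ⟨p, rfl, rfl⟩ :
        IsMedialDart (cSrc p) (cTgt p)).exists_segment_eq_cornerCut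
    obtain ⟨rfl, rfl⟩ := IsCorner.eq_of_cornerSource_eq_of_cornerTarget_eq_holds hv
      (isCorner_cFace p) (hs.trans (cornerSource_cFace p).symm)
      (ht.trans (cornerTarget_cFace p).symm)
    rw [← hseg]
    exact left_mem_segment ℝ _ _
  exact ⟨h.wind_eq_wind_of_l1DistC_le hoff
      (l1DistC_meshPoint_eq_of_mem_cornerCut (isCorner_cFace p) hcut).le
      fun _ hx ↦ h.half_le_l1DistC_meshPoint hx p.1,
    h.wind_eq_wind_of_l1DistC_le hoff (l1DistC_eq_of_mem_cornerCut (isCorner_cFace p) hcut).le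
      fun _ hx ↦ h.half_le_l1DistC_faceCenter hx (cFace p)⟩

/-- An edge off `γ` at a corner with an interior cell has its midpoint strictly inside `γ`. -/
theorem wind_medialPoint_cSrc_ne_zero (h : IsInterfaceLoop ω₀ γ) {p : Site 2 × Fin 4}
    (hp : cSrc p ∉ γ)
    (hcell : (loopCurve 1 0 γ).wind (meshPoint 1 p.1) ≠ 0 ∨
      (loopCurve 1 0 γ).wind (faceCenter (cFace p)) ≠ 0) :
    (loopCurve 1 0 γ).wind (medialPoint 1 (cSrc p)) ≠ 0 := by
  obtain ⟨ev, ef⟩ := wind_medialPoint_cSrc_eq h hp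
  rcases hcell with hv | hf
  · rwa [ev]
  · rwa [ef]

end Summit.CriticalPhenomena.CardyFormulaZ2.Cruxes.NestingRigidity.MarkovCascadeOneGeneration

end
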